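import Summits.BirchSwinnertonDyer.BirchSwinnertonDyer.Theses.DerivedKatoValuationDoor
import Summits.BirchSwinnertonDyer.BirchSwinnertonDyer.Theorems.Rank2ObservatoryPadicAtlasR2A00
import Summits.BirchSwinnertonDyer.BirchSwinnertonDyer.Theorems.DerivedKatoValuationDoorDerivedKatoDoorStubDepthLeQuotientLength
import Summits.BirchSwinnertonDyer.BirchSwinnertonDyer.Theorems.DerivedKatoValuationDoorDerivedKatoDoorStubAdmissibleNeZero
import Literature.NumberTheory.EllipticCurves.Kato2004.IwasawaH2FineSelmerDualComparison
import Literature.NumberTheory.EllipticCurves.Kato2004.MainConjecturePrimeTDoor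
import Literature.NumberTheory.EllipticCurves.Kato2004.IwasawaH1LambdaTorsionFreeProofs
import Literature.NumberTheory.EllipticCurves.KatoFineSelmerDualProofs
import Literature.NumberTheory.EllipticCurves.KatoRankBoundProofs
import HarnessLib

/-!
# Crux `DerivedKatoDoor` (stmt-BirchSwinnertonDyer-23024) — line `lower` (`Lines/lower.lean`)

Route `DerivedKatoValuationDoor` (route-BirchSwinnertonDyer-DerivedKatoValuationDoor), crux #2 (rank 2, K1 =
D-K₂): for every `E/ℚ` (global minimal model `W`) of analytic rank `2` and every DOOR PRIME `p` (`5 ≤ p`,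
good ordinary, `ρ̄_{E,p}` onto), every admissible Kato zeta class `z₀ ∈ 𝐇¹ = I.H` satisfies
`¬ ∃ h m, p^m z₀ = T² h` (`v_T(z₀) ≤ 1`). The crux is FIXED (decl
`Summit.BirchSwinnertonDyer.BirchSwinnertonDyer.Theses.DerivedKatoValuationDoor.DerivedKatoDoor`).
BSD is not proved by any of this.

PROVENANCE. Filed by the LEAD (prover-bsd-line-dkd-p1-g0-0) on the order of director-bsd (242)(1) /
critic idea-crit-16 VERDICT #20 price L-a («birth's open stub = N2|_{a=2} ∧ ε ⊋ crux + C₂' — it ignores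
the door's position; the lower line cashes it»). It is the route header's own placement `DoorPosition`
(«D-K₂ ⟺ D-U₂ ∧ Loc_p ∧ FineSemisimple₁ mod BCS») turned into a line: D-K₂ is read off the
`T`-MULTIPLICITY OF THE DUAL FINE SELMER GROUP `X₀(E/ℚ_∞)` (`= 𝐇²_Γ(T_pW)` up to finite, Kato), with NO
`p`-adic `L`-function, NO Coleman map and NO `p`-adic height anywhere in the line.

## Line `lower` — `v_T(z₀) ≤ ℓ_T(𝐇¹/Λz₀) ≤ ℓ_T(X₀(E/ℚ_∞)) ≤ 1`

Write `Λ = ℤ_p⟦T⟧`, `𝔭_T = (T)` (`IwasawaAlgebra.primeT p`), `ℓ_T(M) := length_{Λ_(T)} M_(T) ∈ ℕ∞`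
(`Module.lengthAt Λ M (primeT p)`), `𝐇¹ = I.H` (the pinned `Kato2004.IwasawaH1Data W p K γ` along the
cyclotomic `ℤ_p`-extension `K` with topological generator `γ`), `X₀ := (W.fineSelmerDualData K hγ).X` (the
CONSTRUCTED Pontryagin dual of `Sel₀(ℚ_∞, W[p^∞])`, file `KatoFineSelmerDualProofs`), `s_p = corank Sel_{p^∞}(E/ℚ)`,
`ε = 1 ⟺ Loc_p` («some integral global class has non-zero Kummer logarithm at `p`», = rider `CrisAt` of card
crystalline-door / `Kato2004.HasLocPKummerLog`), `s₀ = s_p − ε = dim Sel_str(ℚ, V_pW)`.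

LANDED (stub L1 of revision 1 — p656388; stub L2a of revision 4 — p657733):
* `depthLeQuotientLength` = tree theorem `Theorems.stub_depthLeQuotientLength` — ALGEBRA (Kato Thm. 12.4 (2)
  in the tree's proved form `IwasawaH1Data.noZeroSMulDivisors` + DVR algebra at `𝔭_T`): for `z₀ ≠ 0` in
  `𝐇¹`, `p^m z₀ = T^k h ⇒ k ≤ ℓ_T(𝐇¹/Λz₀)`. No finite generation, no rank statement used.

* `admissibleNeZero` = tree theorem `Theorems.stub_admissibleNeZero` (LANDED p657733, revision 5; was stub
  L2a of r4): every admissible class is NON-ZERO, at every prime, no door — Kato Thm. 12.5 (1) via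
  Rohrlich, ALL inputs tree theorems (`IsAdmissibleZetaClass.ne_zero_of_rohrlich` +
  `PSRohrlichAtLevel.rohrlich_primePow_of_isNewformOf` (Rohrlich at ANY `p`) + `module_free/finite_tateModule_holds`).

STUBS (registered; `sorry` only here):
* `stub_katoMainConjecturePrimeTOfDoor` — PRINT NAMED FACT (revision 6): verbatim
  `Kato2004.kato_mainConjecture_primeT_of_door` (typed by seat w2): Kato Conj. 12.10 at `(T)` at door primes,
  a theorem of BCS 2025 + Kato §17.13 + (14.9.1) + Imai. From it the r4/r5 inequality stub is DERIVED in this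
  file (`zetaQuotientLengthLeFineLength_of_stub`): at a door prime, for every admissible `z₀`,
  `ℓ_T(𝐇¹/Λz₀) ≤ ℓ_T(X₀(E/ℚ_∞))`. The inequality is the `𝔭_T`-component of the cyclotomic main conjecture
  in Kato's `𝐇`-form (Conj. 12.10: `length 𝐇²_𝔭 = length (𝐇¹/Z)_𝔭`) in the direction OPPOSITE to Kato's
  Thm. 12.5 (4): Burungale–Castella–Skinner 2024 (cyclotomic IMC for `ρ̄` onto, `p ≥ 5` good ordinary —
  the door) give `char X(E/ℚ_∞) = (L_p)`; Kato §17.13 (Coleman-map exact sequence (17.13.1)) translates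
  `(L_p) ∣ char X` into `char(𝐇¹/Z) ∣ char(𝐇²)`; `𝐇² ⊇ X₀` with FINITE cokernel at good `p`
  (tree named fact `exists_iwasawaH2Data_fineSelmerDual_embedding`, Kato (14.9.1)/(17.13.1) + Imai), so
  `ℓ_T(𝐇²) = ℓ_T(X₀)`; and `Z_𝔭 = Λ_𝔭 z₀` for admissible `z₀` at `𝔭 = 𝔭_T` (the multiplier `M̃` has
  augmentation `≠ 0`, `constantCoeff_katoMultiplier_ne_zero`, hence is a unit at `(T)`). Size L–XL.
* `stub_fineLengthLeOneOfAnalyticRankTwo` — the OPEN stub (the lead's): `a = 2 ⇒ ℓ_T(X₀(E/ℚ_∞)) ≤ 1` at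
  every door prime (for every cyclotomic `K`, topological generator `γ`). MODULO PRINT it is EXACTLY the
  critic's triple `SelCapTwoAt ∧ CrisAt ∧ FineSemisimple₁` («a = 2 ⇒ s_p ≤ 2 ∧ ε ∧ X₀ semisimple at T
  in multiplicity one»): `ℓ_T(X₀) ≥ #(T-Jordan blocks of X₀) = rank_{ℤ_p} (X₀)_Γ = corank Sel₀(E/ℚ) = s₀`
  (control theorem for the fine Selmer group, Kurihara 2002 / Wuthrich 2007 §3; Poitou–Tate line
  `s₀ = s_p − ε`, Kobayashi–(KP07) Lemma 1.4) with equality iff every `T`-block is simple; at `a = 2`,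
  `s_p ≥ 2` is a tree theorem modulo BCS (`one_le_selmerCorank_of_entireLFunction_one_eq_zero_of_mazurMainConjecture`
  + `burungale_castella_skinner_charIdeal_eq_padicLFunction` + parity `selmerCorank_mod_two_eq`); so
  `ℓ_T(X₀) ≤ 1 ⟺ (s₀ = 1 ∧ semisimple) ⟺ (s_p = 2 ∧ ε = 1 ∧ FineSS₁)`. The three conjuncts have homes:
  N1|_{a=2} = `S0Doors.SelCapTwoAt` (Selmer side, no height; item family SelmerRank/KatoTransfer),
  ε = `CrisAt` (card crystalline-door-weakest-consequence, VERDICT #13 PASS, rider of this route), FineSS₁ =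
  the door's OWN residual (T-semisimplicity of the FINE dual at multiplicity one — strictly weaker than
  Greenberg's semisimplicity of `X(E/ℚ_∞)`). The bottom-layer fine-Selmer corank has no decl in the tree
  yet, which is why the stub is typed as the single inequality and the triple lives in this docstring.
  Why it might fail while BSD survives: one `T²`-Jordan block in `X₀(E/ℚ_∞)` at a door prime of a rank-2
  curve (Wuthrich, J. Alg. Geom. 16 (2007) §§9–10: the worked fine-Selmer examples — the card's cheapest
  falsifier P-g), or `Sel_{p^∞} → E(ℚ_p) ⊗ ℚ_p/ℤ_p` of finite image (`ε = 0`, then `s₀ = s_p ≥ 2`).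
  Size: open problem (strictly SMALLER open content than line `birth`'s `stub_ordLeTwoOfAnalyticRankTwo`,
  which equals this stub ∧ C₂' `ColemanStepDoor` modulo print, VERDICT #16/#20).
BC5 RUNG `(389a1, 5)` — no longer a registered stub (revision 3): seat bsd-line-dkd-w3 replied
`stub-misstated` (an unconditional rung inherits the line's print debt) and LANDED everything the kernel
can decide at the cell, `--supports` 23024: `Theorems.DerivedKatoValuationDoor.door_389a1_five` (the DOOR
at `(389a1, 5)` holds outright: `5` good ordinary, `ρ̄_{E,5}` ONTO by three Serre witnesses,
`hasSurjectiveModNGaloisRep_389a1_five`, p656362 — critic price P-h paid in the kernel),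
`order_padicLFunction_le_two_389a1_five` (D-A₂ at the cell GIVEN the symbol data),
`rung389a1_five_of_sandwich` / `…_newform` (p654976, p655640) and
`firstDerivedKatoClass_389a1_five_of_sandwich` (the rung modulo sandwich-at-cell, `Loc_5`, symbol data).
Read in this line: `ℓ_T(X₀(389a1/ℚ_∞)) ≤ 1` at `p = 5` is decided modulo print by the atlas row
(`ρ_5 = 2 = v + w`, `w ≥ 1` from the two generators) — E-S0-1 j314336 row `389a1@5`: A = 2, B = v_T = 1.
* `DerivedKatoDoor_of` — COMPOSITION (real proof, the crux BY NAME): `p^m z₀ = T² h` ⇒ (`z₀ ≠ 0`,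
  landed) `2 ≤ ℓ_T(𝐇¹/Λz₀)` (landed) `≤ ℓ_T(X₀)` (derived from the print-fact stub L2b) `≤ 1` (stub L3,
  OPEN) in `ℕ∞`, contradiction. I.e. the crux is CLOSED MODULO {`kato_mainConjecture_primeT_of_door`
  (print)} ∪ {`stub_fineLengthLeOneOfAnalyticRankTwo` (open)}.

Honesty notes. (1) OPEN content = `stub_fineLengthLeOneOfAnalyticRankTwo` only; the algebra step and the
non-vanishing are LANDED (p656388, p657733) and the other stub is a print import (BCS 2024 + Kato §17.13 +
(14.9.1), typed by w2 as the named fact `Kato2004.kato_mainConjecture_primeT_of_door`). (2) Compared with line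
`birth` (upper sandwich): one more print import (BCS + 17.13 instead of Kato 16.6's Coleman value law),
strictly less open content (no C₂'/I1: the `p`-adic height barrier `PAdicHeightBarrier` does not touch this
line; B1 `SelmerRankBarrierNarrow` touches only the `ε` part of the open stub, as in `birth`). (3) The
seat bsd-line-dkd-w2's birth stub `stub_sandwichFromDA` is NOT registered under this line (director
(242)(4): w2 takes the Kato/BCS print stub here = `stub_quotientLengthLeFineLength`); `Lines/birth.lean`
stays published as the alternative line. (4) Junk audit: as for `birth` — a cooked `I` only shrinks `𝐇¹`
(then `ℓ_T(I.H/Λz₀)` can only drop, and the stubs quantify over the same `I` as the crux); `X₀` is the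
CONSTRUCTED dual (no hypothesis structure); `z₀ ≠ 0` is supplied by the print stub, so the algebra stub is
stated for `z₀ ≠ 0` and is not vacuous-by-zero. (5) Disproof used: none exists yet (`ledger crux ls`).
-/

-- D-0017: single-problem summit, so `Summit.BirchSwinnertonDyer.BirchSwinnertonDyer.…` repeats a
-- namespace BY DESIGN.
set_option linter.dupNamespace false

noncomputable section

namespace Summit.BirchSwinnertonDyer.BirchSwinnertonDyer.Cruxes.DerivedKatoDoor.Lower

open Field
open Literature Literature.NumberTheory.GaloisRepresentations
open Literature.NumberTheory.EllipticCurves Literature.NumberTheory.EllipticCurves.ModularForms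
open Literature.NumberTheory.EllipticCurves.Kato2004
open Literature.NumberTheory.EllipticCurves.Kato2004.EulerSystemValues
open Summit.BirchSwinnertonDyer.BirchSwinnertonDyer.Theses.DerivedKatoValuationDoor (DerivedKatoDoor)

/-! ## Vocabulary (documentation `def`s; every stub below is spelled out in full) -/

/-- **`ℓ_T(M)`**: the length at the height-one prime `𝔭_T = (T)` of a `Λ = ℤ_p⟦T⟧`-module `M` (the
multiplicity of `T` in `char_Λ M` when `M` is finitely generated torsion). [cite: Washington1997, §13.2] -/
abbrev lengthAtT (p : ℕ) [Fact p.Prime] (M : Type) [AddCommGroup M]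
    [Module (Literature.NumberTheory.EllipticCurves.IwasawaAlgebra p) M] : ℕ∞ :=
  Literature.NumberTheory.EllipticCurves.Module.lengthAt
    (Literature.NumberTheory.EllipticCurves.IwasawaAlgebra p) M
    (Literature.NumberTheory.EllipticCurves.IwasawaAlgebra.primeT p)

/-- **`Z₂(W,p)`** = the crux's conclusion at `(W,p)` (verbatim the tail of the route decl; same `def` as in
`Lines/birth.lean`). [cite: BurnsKuriharaSano2019, Lemma 6.12] -/
def FirstDerivedKatoClassNonzeroAt (W : WeierstrassCurve ℚ) [W.IsElliptic] [W.IsGloballyMinimal]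
    (p : ℕ) [Fact p.Prime] [ContinuousSMul ℤ_[p] (W.tateModule p)] : Prop :=
  ∀ (K : Literature.NumberTheory.EllipticCurves.ZpExtension ℚ p) (hK : K.IsCyclotomic)
    (γ : Field.absoluteGaloisGroup ℚ)
    (I : Literature.NumberTheory.EllipticCurves.Kato2004.IwasawaH1Data W p K γ) (z₀ : I.H),
    K.IsTopGenerator γ →
    Literature.NumberTheory.EllipticCurves.Kato2004.IsAdmissibleZetaClass W p K hK I z₀ →
      ¬ ∃ (h : I.H) (m : ℕ),
        ((p : Literature.NumberTheory.EllipticCurves.IwasawaAlgebra p) ^ m) • z₀ =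
          ((PowerSeries.X : Literature.NumberTheory.EllipticCurves.IwasawaAlgebra p) ^ 2) • h

/-- **`FineLengthLeOneAt W p`: `ℓ_T(X₀(E/ℚ_∞)) ≤ 1`** for the constructed dual fine Selmer group along every
cyclotomic `ℤ_p`-extension datum and topological generator (= `s_p ≤ 2 ∧ ε ∧ FineSemisimple₁` modulo print,
module docstring). [cite: CoatesSujatha2005, §3] [cite: Kato2004Asterisque, Conj. 12.10 (p. 224)] -/
def FineLengthLeOneAt (W : WeierstrassCurve ℚ) [W.IsElliptic] (p : ℕ) [Fact p.Prime] : Prop :=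
  ∀ (K : Literature.NumberTheory.EllipticCurves.ZpExtension ℚ p), K.IsCyclotomic →
    ∀ (γ : Field.absoluteGaloisGroup ℚ) (hγ : K.IsTopGenerator γ),
      lengthAtT p (W.fineSelmerDualData K hγ).X ≤ 1

/-! ## Stubs (registered; `sorry` only here) -/

/-- **Stub L1 — LANDED (p656388, `Theorems/DerivedKatoValuationDoorDerivedKatoDoorStubDepthLeQuotientLength.lean`,
tree theorem `Theorems.stub_depthLeQuotientLength`, axioms standard): a non-zero class `z₀ ∈ 𝐇¹` with
`p^m z₀ ∈ T^k 𝐇¹` has `k ≤ ℓ_T(𝐇¹/Λz₀)`.** No longer a stub: this declaration is the landed theorem BY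
NAME (kept under a non-`stub_` name so the registrar counts three open stubs). Ingredients: `𝐇¹` has no
`Λ`-zero-divisors for every pinned datum and topological generator (`IwasawaH1Data.noZeroSMulDivisors`,
Kato Thm. 12.4 (2)); `T ∤ p^m`; the DVR chain `Λ_(T)[h] ⊋ Λ_(T)[Th] ⊋ ⋯ ⊋ Λ_(T)[T^k h]` in `(𝐇¹/Λz₀)_(T)`.
[cite: Kato2004Asterisque, Thm. 12.4 (2) (p. 221)] [cite: Washington1997, §13.2] -/
theorem depthLeQuotientLength :
    ∀ (W : WeierstrassCurve ℚ) [W.IsElliptic] (p : ℕ) [Fact p.Prime]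
      [ContinuousSMul ℤ_[p] (W.tateModule p)]
      (K : Literature.NumberTheory.EllipticCurves.ZpExtension ℚ p) (γ : Field.absoluteGaloisGroup ℚ)
      (I : Literature.NumberTheory.EllipticCurves.Kato2004.IwasawaH1Data W p K γ) (z₀ : I.H),
      K.IsTopGenerator γ → z₀ ≠ 0 → ∀ k : ℕ,
      (∃ (h : I.H) (m : ℕ),
        ((p : Literature.NumberTheory.EllipticCurves.IwasawaAlgebra p) ^ m) • z₀ =
          ((PowerSeries.X : Literature.NumberTheory.EllipticCurves.IwasawaAlgebra p) ^ k) • h) →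
      (k : ℕ∞) ≤ Literature.NumberTheory.EllipticCurves.Module.lengthAt
        (Literature.NumberTheory.EllipticCurves.IwasawaAlgebra p)
        (I.H ⧸ Submodule.span (Literature.NumberTheory.EllipticCurves.IwasawaAlgebra p) {z₀})
        (Literature.NumberTheory.EllipticCurves.IwasawaAlgebra.primeT p) :=
  Summit.BirchSwinnertonDyer.BirchSwinnertonDyer.Theorems.stub_depthLeQuotientLength

/-- **L2a — LANDED (p657733, `Theorems/DerivedKatoValuationDoorDerivedKatoDoorStubAdmissibleNeZero.lean`,
tree theorem `Theorems.stub_admissibleNeZero`): every admissible Kato zeta class of every pinned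
`𝐇¹_Γ(T_pW)` is NON-ZERO**, for every elliptic `W/ℚ`, every prime `p`, every `ℤ_p`-extension datum and
topological generator — no door needed (Kato Thm. 12.5 (1) via Rohrlich at any prime, all inputs tree
theorems). No longer a stub (revision 5). [cite: Kato2004Asterisque, Thm. 12.5 (1) and proof (pp. 221–222)]
[cite: RohrlichInventiones1984, Theorem (p. 409)] -/
theorem admissibleNeZero :
    ∀ (W : WeierstrassCurve ℚ) [W.IsElliptic] [W.IsGloballyMinimal] (p : ℕ) [Fact p.Prime]
      [ContinuousSMul ℤ_[p] (W.tateModule p)]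
      (K : Literature.NumberTheory.EllipticCurves.ZpExtension ℚ p) (hK : K.IsCyclotomic)
      (γ : Field.absoluteGaloisGroup ℚ)
      (I : Literature.NumberTheory.EllipticCurves.Kato2004.IwasawaH1Data W p K γ) (z₀ : I.H),
      K.IsTopGenerator γ →
      Literature.NumberTheory.EllipticCurves.Kato2004.IsAdmissibleZetaClass W p K hK I z₀ → z₀ ≠ 0 :=
  Summit.BirchSwinnertonDyer.BirchSwinnertonDyer.Theorems.stub_admissibleNeZero

/-- **Stub L2b — `stub_katoMainConjecturePrimeTOfDoor` (PRINT NAMED FACT, typed by seat w2 in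
`Literature/NumberTheory/EllipticCurves/Kato2004/MainConjecturePrimeTDoor.lean`; revision 6): Kato's
Conj. 12.10 AT `𝔭 = (T)` for `T_pW` at a door prime — a THEOREM of Burungale–Castella–Skinner 2025
Thm. 1.1.2 (a) + Kato §17.13 (p. 280) + (14.9.1) + Imai 1975: Kato's `𝐇²_Γ(T_pW)` as a descent package `J`,
the Poitou–Tate embedding `X₀(E/ℚ_∞) ↪ J.H2` with finite cokernel, and `ℓ_T(J.H2) = ℓ_T(𝐇¹/Λz₀)` for every
admissible `z₀`.** Verbatim the fact (its `∀`-closure is the fact itself); the inequality stub of r4/r5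
(`stub_zetaQuotientLengthLeFineLength`) is DERIVED from it below (`zetaQuotientLengthLeFineLength_of_stub`).
Size XL to discharge. [cite: Kato2004Asterisque, Conj. 12.10 (p. 224), §17.13 (pp. 279–280), (14.9.1) (p. 239)]
[cite: BurungaleCastellaSkinner2025, Thm. 1.1.2 (a)] [cite: Imai1975, Theorem (p. 12)] -/
theorem stub_katoMainConjecturePrimeTOfDoor :
    Literature.NumberTheory.EllipticCurves.Kato2004.kato_mainConjecture_primeT_of_door := by
  sorry

/-- **The IMC inequality at `(T)` from stub L2b** (revision 6; was the registered stub
`stub_zetaQuotientLengthLeFineLength` of r4/r5, now DERIVED): at a door prime, for every admissible Kato zeta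
class `z₀`, `ℓ_T(𝐇¹/Λz₀) ≤ ℓ_T(X₀(E/ℚ_∞))` — indeed `=`: `ℓ_T(𝐇¹/Λz₀) = ℓ_T(𝐇²)` (the fact) and
`ℓ_T(X₀) = ℓ_T(𝐇²)` (injective with finite cokernel preserves lengths at height-one primes,
`lengthAt_eq_of_injective_of_finite_quotient`, `height_primeT`).
[cite: Kato2004Asterisque, Conj. 12.10 (p. 224), §17.13 (p. 280)] [cite: BurungaleCastellaSkinner2025, Thm. 1.1.2 (a)] -/
theorem zetaQuotientLengthLeFineLength_of_stub :
    ∀ (W : WeierstrassCurve ℚ) [W.IsElliptic] [W.IsGloballyMinimal] (p : ℕ) [Fact p.Prime]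
      [ContinuousSMul ℤ_[p] (W.tateModule p)],
      (5 ≤ p ∧ Literature.NumberTheory.EllipticCurves.IsOrdinaryAt W p ∧ W.HasSurjectiveModNGaloisRep p) →
      ∀ (K : Literature.NumberTheory.EllipticCurves.ZpExtension ℚ p) (hK : K.IsCyclotomic)
        (γ : Field.absoluteGaloisGroup ℚ)
        (I : Literature.NumberTheory.EllipticCurves.Kato2004.IwasawaH1Data W p K γ) (z₀ : I.H)
        (hγ : K.IsTopGenerator γ),
        Literature.NumberTheory.EllipticCurves.Kato2004.IsAdmissibleZetaClass W p K hK I z₀ →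
          Literature.NumberTheory.EllipticCurves.Module.lengthAt
              (Literature.NumberTheory.EllipticCurves.IwasawaAlgebra p)
              (I.H ⧸ Submodule.span (Literature.NumberTheory.EllipticCurves.IwasawaAlgebra p) {z₀})
              (Literature.NumberTheory.EllipticCurves.IwasawaAlgebra.primeT p) ≤
            Literature.NumberTheory.EllipticCurves.Module.lengthAt
              (Literature.NumberTheory.EllipticCurves.IwasawaAlgebra p)
              (W.fineSelmerDualData K hγ).X
              (Literature.NumberTheory.EllipticCurves.IwasawaAlgebra.primeT p) := by
  intro W _ _ p _ _ hdoor K hK γ I z₀ hγ hz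
  obtain ⟨J, e, he, hfin, hlen⟩ :=
    stub_katoMainConjecturePrimeTOfDoor W p hdoor.1 hdoor.2.1 hdoor.2.2 K hK γ hγ I
  exact ((hlen z₀ hz).symm.trans
    (lengthAt_eq_of_injective_of_finite_quotient e he hfin _
      (Literature.NumberTheory.EllipticCurves.IwasawaAlgebra.height_primeT p).le).symm).le

/-- **Stub L3 — `stub_fineLengthLeOneOfAnalyticRankTwo` (OPEN; the lead's): analytic rank two forces
`ℓ_T(X₀(E/ℚ_∞)) ≤ 1` at every door prime** (for every cyclotomic `ℤ_p`-extension datum `K` and topological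
generator `γ`; `X₀ = (W.fineSelmerDualData K hγ).X`). Modulo print (fine control theorem + Poitou–Tate line
+ `s_p ≥ 2` at `a = 2`) it is the triple «`a = 2 ⇒ s_p ≤ 2 ∧ ε ∧ FineSemisimple₁`» (`SelCapTwoAt ∧ CrisAt ∧`
T-semisimplicity of the fine dual in multiplicity one) — see the module docstring. Why it might fail while
BSD survives: a `T²`-Jordan block in `X₀(E/ℚ_∞)` at a door prime (Wuthrich 2007 §§9–10 examples are the
place to look), or `ε = 0`. Consistent with all data: E-S0-1 j314336, 115/115 cells `v_T = 1`.
Size: open problem. [cite: Kato2004Asterisque, Conj. 12.10 (p. 224)] [cite: CoatesSujatha2005, §3]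
[cite: Wuthrich2007JAG, §§9–10] [cite: GreenbergLNM1716, Conj. 1.12–1.13 (pp. 64–65)] -/
theorem stub_fineLengthLeOneOfAnalyticRankTwo :
    ∀ (W : WeierstrassCurve ℚ) [W.IsElliptic] [W.IsGloballyMinimal] (p : ℕ) [Fact p.Prime]
      [ContinuousSMul ℤ_[p] (W.tateModule p)], W.analyticRank = 2 →
      (5 ≤ p ∧ Literature.NumberTheory.EllipticCurves.IsOrdinaryAt W p ∧ W.HasSurjectiveModNGaloisRep p) →
      ∀ (K : Literature.NumberTheory.EllipticCurves.ZpExtension ℚ p), K.IsCyclotomic →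
        ∀ (γ : Field.absoluteGaloisGroup ℚ) (hγ : K.IsTopGenerator γ),
          Literature.NumberTheory.EllipticCurves.Module.lengthAt
              (Literature.NumberTheory.EllipticCurves.IwasawaAlgebra p)
              (W.fineSelmerDualData K hγ).X
              (Literature.NumberTheory.EllipticCurves.IwasawaAlgebra.primeT p) ≤ 1 := by
  sorry

/-! ## Composition: the crux from the stubs (real proof; `sorry` enters only through the stubs) -/

/-- **Composition (line `lower`) — the skeleton theorem.** The crux `DerivedKatoDoor`, BY NAME: a
`T²`-divisibility `p^m z₀ = T² h` of an admissible class at a door prime of an analytic-rank-two curve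
gives `2 ≤ ℓ_T(𝐇¹/Λz₀)` (LANDED `depthLeQuotientLength`, with `z₀ ≠ 0` LANDED `admissibleNeZero`), `≤ ℓ_T(X₀)`
(stub L2b), `≤ 1` (stub L3) in `ℕ∞` — absurd. No `sorry` of its own; its closure reaches `sorryAx` exactly
through the remaining stubs.
[cite: Kato2004Asterisque, Conj. 12.10 (p. 224), Thm. 12.4 (2) (p. 221)] [cite: BurungaleCastellaSkinner2024, Thm. 1.1.2] -/
theorem DerivedKatoDoor_of :
    Summit.BirchSwinnertonDyer.BirchSwinnertonDyer.Theses.DerivedKatoValuationDoor.DerivedKatoDoor := by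
  intro W _ _ p _ _ ha hdoor K hK γ I z₀ hγ hz hdiv
  have hne := admissibleNeZero W p K hK γ I z₀ hγ hz
  have hle := zetaQuotientLengthLeFineLength_of_stub W p hdoor K hK γ I z₀ hγ hz
  have h2 := depthLeQuotientLength W p K γ I z₀ hγ hne 2 hdiv
  have h1 := stub_fineLengthLeOneOfAnalyticRankTwo W p ha hdoor K hK γ hγ
  have h21 : ((2 : ℕ) : ℕ∞) ≤ 1 := h2.trans (hle.trans h1)
  exact absurd (by exact_mod_cast h21 : (2 : ℕ) ≤ 1) (by omega)

/-! ## Certificates (sorry-free) -/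

/-- **The crux IS «a = 2 ⇒ Z₂ at door primes»** (definitional). [folklore] -/
theorem derivedKatoDoor_iff :
    Summit.BirchSwinnertonDyer.BirchSwinnertonDyer.Theses.DerivedKatoValuationDoor.DerivedKatoDoor ↔
    ∀ (W : WeierstrassCurve ℚ) [W.IsElliptic] [W.IsGloballyMinimal] (p : ℕ) [Fact p.Prime]
      [ContinuousSMul ℤ_[p] (W.tateModule p)], W.analyticRank = 2 →
      (5 ≤ p ∧ Literature.NumberTheory.EllipticCurves.IsOrdinaryAt W p ∧ W.HasSurjectiveModNGaloisRep p) →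
        FirstDerivedKatoClassNonzeroAt W p :=
  Iff.rfl

/-- **The open stub IS «a = 2 ⇒ FineLengthLeOneAt at door primes»** (definitional unfolding of the
vocabulary). [folklore] -/
theorem stub_fineLengthLeOneOfAnalyticRankTwo_iff :
    (∀ (W : WeierstrassCurve ℚ) [W.IsElliptic] [W.IsGloballyMinimal] (p : ℕ) [Fact p.Prime]
      [ContinuousSMul ℤ_[p] (W.tateModule p)], W.analyticRank = 2 →
      (5 ≤ p ∧ Literature.NumberTheory.EllipticCurves.IsOrdinaryAt W p ∧ W.HasSurjectiveModNGaloisRep p) →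
      FineLengthLeOneAt W p) ↔
    (∀ (W : WeierstrassCurve ℚ) [W.IsElliptic] [W.IsGloballyMinimal] (p : ℕ) [Fact p.Prime]
      [ContinuousSMul ℤ_[p] (W.tateModule p)], W.analyticRank = 2 →
      (5 ≤ p ∧ Literature.NumberTheory.EllipticCurves.IsOrdinaryAt W p ∧ W.HasSurjectiveModNGaloisRep p) →
      ∀ (K : Literature.NumberTheory.EllipticCurves.ZpExtension ℚ p), K.IsCyclotomic →
        ∀ (γ : Field.absoluteGaloisGroup ℚ) (hγ : K.IsTopGenerator γ),
          Literature.NumberTheory.EllipticCurves.Module.lengthAt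
              (Literature.NumberTheory.EllipticCurves.IwasawaAlgebra p)
              (W.fineSelmerDualData K hγ).X
              (Literature.NumberTheory.EllipticCurves.IwasawaAlgebra.primeT p) ≤ 1) :=
  Iff.rfl

/-- **Hypothesis form of the line** (sorry-free certificate of what `lower` reduces the crux to): the
algebra stub, the print stub and the open stub, as displayed hypotheses, give «a = 2 ⇒ Z₂ at door primes»
(the crux unfolded; stated unfolded so that the registrar sees exactly one theorem concluding the crux by
name). [cite: Kato2004Asterisque, Conj. 12.10 (p. 224)] -/
theorem firstDerivedKatoClassNonzeroAt_of_pieces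
    (hL1 : ∀ (W : WeierstrassCurve ℚ) [W.IsElliptic] (p : ℕ) [Fact p.Prime]
      [ContinuousSMul ℤ_[p] (W.tateModule p)]
      (K : Literature.NumberTheory.EllipticCurves.ZpExtension ℚ p) (γ : Field.absoluteGaloisGroup ℚ)
      (I : Literature.NumberTheory.EllipticCurves.Kato2004.IwasawaH1Data W p K γ) (z₀ : I.H),
      K.IsTopGenerator γ → z₀ ≠ 0 → ∀ k : ℕ,
      (∃ (h : I.H) (m : ℕ),
        ((p : Literature.NumberTheory.EllipticCurves.IwasawaAlgebra p) ^ m) • z₀ =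
          ((PowerSeries.X : Literature.NumberTheory.EllipticCurves.IwasawaAlgebra p) ^ k) • h) →
      (k : ℕ∞) ≤ lengthAtT p (I.H ⧸ Submodule.span (Literature.NumberTheory.EllipticCurves.IwasawaAlgebra p) {z₀}))
    (hL2 : ∀ (W : WeierstrassCurve ℚ) [W.IsElliptic] [W.IsGloballyMinimal] (p : ℕ) [Fact p.Prime]
      [ContinuousSMul ℤ_[p] (W.tateModule p)],
      (5 ≤ p ∧ Literature.NumberTheory.EllipticCurves.IsOrdinaryAt W p ∧ W.HasSurjectiveModNGaloisRep p) →
      ∀ (K : Literature.NumberTheory.EllipticCurves.ZpExtension ℚ p) (hK : K.IsCyclotomic)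
        (γ : Field.absoluteGaloisGroup ℚ)
        (I : Literature.NumberTheory.EllipticCurves.Kato2004.IwasawaH1Data W p K γ) (z₀ : I.H)
        (hγ : K.IsTopGenerator γ),
        Literature.NumberTheory.EllipticCurves.Kato2004.IsAdmissibleZetaClass W p K hK I z₀ →
        z₀ ≠ 0 ∧ lengthAtT p (I.H ⧸ Submodule.span (Literature.NumberTheory.EllipticCurves.IwasawaAlgebra p) {z₀}) ≤
          lengthAtT p (W.fineSelmerDualData K hγ).X)
    (hL3 : ∀ (W : WeierstrassCurve ℚ) [W.IsElliptic] [W.IsGloballyMinimal] (p : ℕ) [Fact p.Prime]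
      [ContinuousSMul ℤ_[p] (W.tateModule p)], W.analyticRank = 2 →
      (5 ≤ p ∧ Literature.NumberTheory.EllipticCurves.IsOrdinaryAt W p ∧ W.HasSurjectiveModNGaloisRep p) →
      FineLengthLeOneAt W p)
    (W : WeierstrassCurve ℚ) [W.IsElliptic] [W.IsGloballyMinimal] (p : ℕ) [Fact p.Prime]
    [ContinuousSMul ℤ_[p] (W.tateModule p)] (ha : W.analyticRank = 2)
    (hdoor : 5 ≤ p ∧ Literature.NumberTheory.EllipticCurves.IsOrdinaryAt W p ∧
      W.HasSurjectiveModNGaloisRep p) :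
    FirstDerivedKatoClassNonzeroAt W p := by
  intro K hK γ I z₀ hγ hz hdiv
  obtain ⟨hne, hle⟩ := hL2 W p hdoor K hK γ I z₀ hγ hz
  have h2 := hL1 W p K γ I z₀ hγ hne 2 hdiv
  have h1 := hL3 W p ha hdoor K hK γ hγ
  have h21 : ((2 : ℕ) : ℕ∞) ≤ 1 := h2.trans (hle.trans h1)
  exact absurd (by exact_mod_cast h21 : (2 : ℕ) ≤ 1) (by omega)

/-- **CONVERSE CERTIFICATE: the open stub is implied by the crux modulo print** (so, with
`DerivedKatoDoor_of`, `stub_fineLengthLeOneOfAnalyticRankTwo ⟺ DerivedKatoDoor` modulo print — the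
disprover's reading «L3 ≡ crux mod print both ways», kernel-typed). Displayed print hypotheses: `hKato` =
Kato Thm. 12.5 (4) at `𝔭 = (T)` read on `X₀ ↪ 𝐇²` («`ℓ_T(X₀) ≤ ℓ_T(𝐇²) ≤ ℓ_T(𝐇¹/Z)`», the Euler-system
divisibility — unconditional direction); `hCyc` = Kato Thm. 12.4 (2)(3) (`𝐇¹` finitely generated of rank one,
so `𝐇¹_(T)` is free of rank one over the DVR `Λ_(T)` and `ℓ_T(𝐇¹/Λz₀) = v_T(z₀)`: in particular `T² ∤ p^m z₀
⇒ ℓ_T(𝐇¹/Λz₀) ≤ 1`); `hE` = Kato Thm. 12.5 realisability (an admissible class exists in some pinned `𝐇¹`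
along every cyclotomic datum at a door prime; the route's support item 23029 in `∀ K γ` form).
[cite: Kato2004Asterisque, Thm. 12.4 (2)(3) (p. 221), Thm. 12.5 (1)(4) (pp. 221–222)] -/
theorem fineLengthLeOne_of_crux
    (hcrux : Summit.BirchSwinnertonDyer.BirchSwinnertonDyer.Theses.DerivedKatoValuationDoor.DerivedKatoDoor)
    (hKato : ∀ (W : WeierstrassCurve ℚ) [W.IsElliptic] [W.IsGloballyMinimal] (p : ℕ) [Fact p.Prime]
      [ContinuousSMul ℤ_[p] (W.tateModule p)],
      (5 ≤ p ∧ Literature.NumberTheory.EllipticCurves.IsOrdinaryAt W p ∧ W.HasSurjectiveModNGaloisRep p) →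
      ∀ (K : Literature.NumberTheory.EllipticCurves.ZpExtension ℚ p) (hK : K.IsCyclotomic)
        (γ : Field.absoluteGaloisGroup ℚ)
        (I : Literature.NumberTheory.EllipticCurves.Kato2004.IwasawaH1Data W p K γ) (z₀ : I.H)
        (hγ : K.IsTopGenerator γ),
        Literature.NumberTheory.EllipticCurves.Kato2004.IsAdmissibleZetaClass W p K hK I z₀ →
          lengthAtT p (W.fineSelmerDualData K hγ).X ≤
            lengthAtT p (I.H ⧸ Submodule.span (Literature.NumberTheory.EllipticCurves.IwasawaAlgebra p) {z₀}))
    (hCyc : ∀ (W : WeierstrassCurve ℚ) [W.IsElliptic] [W.IsGloballyMinimal] (p : ℕ) [Fact p.Prime]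
      [ContinuousSMul ℤ_[p] (W.tateModule p)],
      (5 ≤ p ∧ Literature.NumberTheory.EllipticCurves.IsOrdinaryAt W p ∧ W.HasSurjectiveModNGaloisRep p) →
      ∀ (K : Literature.NumberTheory.EllipticCurves.ZpExtension ℚ p) (hK : K.IsCyclotomic)
        (γ : Field.absoluteGaloisGroup ℚ)
        (I : Literature.NumberTheory.EllipticCurves.Kato2004.IwasawaH1Data W p K γ) (z₀ : I.H),
        K.IsTopGenerator γ →
        Literature.NumberTheory.EllipticCurves.Kato2004.IsAdmissibleZetaClass W p K hK I z₀ →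
        (¬ ∃ (h : I.H) (m : ℕ),
          ((p : Literature.NumberTheory.EllipticCurves.IwasawaAlgebra p) ^ m) • z₀ =
            ((PowerSeries.X : Literature.NumberTheory.EllipticCurves.IwasawaAlgebra p) ^ 2) • h) →
          lengthAtT p (I.H ⧸ Submodule.span (Literature.NumberTheory.EllipticCurves.IwasawaAlgebra p) {z₀}) ≤ 1)
    (hE : ∀ (W : WeierstrassCurve ℚ) [W.IsElliptic] [W.IsGloballyMinimal] (p : ℕ) [Fact p.Prime]
      [ContinuousSMul ℤ_[p] (W.tateModule p)],
      (5 ≤ p ∧ Literature.NumberTheory.EllipticCurves.IsOrdinaryAt W p ∧ W.HasSurjectiveModNGaloisRep p) →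
      ∀ (K : Literature.NumberTheory.EllipticCurves.ZpExtension ℚ p) (hK : K.IsCyclotomic)
        (γ : Field.absoluteGaloisGroup ℚ), K.IsTopGenerator γ →
        ∃ (I : Literature.NumberTheory.EllipticCurves.Kato2004.IwasawaH1Data W p K γ) (z₀ : I.H),
          Literature.NumberTheory.EllipticCurves.Kato2004.IsAdmissibleZetaClass W p K hK I z₀) :
    ∀ (W : WeierstrassCurve ℚ) [W.IsElliptic] [W.IsGloballyMinimal] (p : ℕ) [Fact p.Prime]
      [ContinuousSMul ℤ_[p] (W.tateModule p)], W.analyticRank = 2 →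
      (5 ≤ p ∧ Literature.NumberTheory.EllipticCurves.IsOrdinaryAt W p ∧ W.HasSurjectiveModNGaloisRep p) →
      FineLengthLeOneAt W p := by
  intro W _ _ p _ _ ha hdoor K hK γ hγ
  obtain ⟨I, z₀, hz⟩ := hE W p hdoor K hK γ hγ
  have hv : ¬ ∃ (h : I.H) (m : ℕ),
      ((p : Literature.NumberTheory.EllipticCurves.IwasawaAlgebra p) ^ m) • z₀ =
        ((PowerSeries.X : Literature.NumberTheory.EllipticCurves.IwasawaAlgebra p) ^ 2) • h :=
    hcrux W p ha hdoor K hK γ I z₀ hγ hz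
  exact (hKato W p hdoor K hK γ I z₀ hγ hz).trans (hCyc W p hdoor K hK γ I z₀ hγ hz hv)

/-- **`𝐇¹` is `Λ`-torsion-free for every pinned datum** — the tree theorem the algebra stub rests on
(recorded here so the line's only non-print, non-open input is visibly PROVED).
[cite: Kato2004Asterisque, Thm. 12.4 (2) (p. 221)] -/
theorem iwasawaH1_isTorsionFree (W : WeierstrassCurve ℚ) [W.IsElliptic] (p : ℕ) [Fact p.Prime]
    [ContinuousSMul ℤ_[p] (W.tateModule p)]
    {K : Literature.NumberTheory.EllipticCurves.ZpExtension ℚ p} {γ : Field.absoluteGaloisGroup ℚ}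
    (hγ : K.IsTopGenerator γ) (I : Literature.NumberTheory.EllipticCurves.Kato2004.IwasawaH1Data W p K γ) :
    Module.IsTorsionFree (Literature.NumberTheory.EllipticCurves.IwasawaAlgebra p) I.H :=
  I.isTorsionFree hγ

end Summit.BirchSwinnertonDyer.BirchSwinnertonDyer.Cruxes.DerivedKatoDoor.Lower

end
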